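import Mathlib.CategoryTheory.Groupoid
import Mathlib.CategoryTheory.NatIso
import Mathlib.CategoryTheory.Whiskering
import Mathlib.CategoryTheory.Products.Basic
import Literature.IUT.HodgeTheaters.Conventions
import Literature.IUT.HodgeTheaters.InitialThetaData
import HarnessLib

/-!
# [IUTchI] §3: Θ-Hodge theaters and the Θ-link
# (Examples 3.2–3.5 as an INTERFACE; Definition 3.6; Corollary 3.7)

S. Mochizuki, *Inter-universal Teichmüller theory I*, §3, kurims final manuscript (May 2020)
pp. 69–94 [claim: Mochizuki2012, status: disputed]. DEFINITIONS and `Prop`-valued statements only;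
nothing is asserted; no side is taken on the disputed step of [IUTchIII].

**What the text does.** Given initial Θ-data (Def. 3.1), Examples 3.2 (`v ∈ V̲^bad`), 3.3
(`v ∈ V̲^good ∩ V̲^non`), 3.4 (`v ∈ V̲^arc`) attach to each `v ∈ V̲` a reference collection of data
`F̲_v` (a tempered Frobenioid [EtTh]; a `p_v`-adic Frobenioid [FrdII] Ex. 1.1; a triple
`(C_v, D_v, κ_v)` of an archimedean Frobenioid [FrdII] Ex. 3.3, an Aut-holomorphic orbispace
[AbsTopIII] Def. 2.1 and a Kummer structure), from which one constructs "category-theoretically" /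
"algorithmically" the base categories `D_v ⊇ D⊢_v`, the split Frobenioids `F⊢_v = (C⊢_v, τ⊢_v)`
and their Θ-versions `F^Θ_v = (C^Θ_v, τ^Θ_v)` together with a natural isomorphism
`F⊢_v ⥲ F^Θ_v` (Ex. 3.2 (v): `q̲_v ↦ Θ̲_v`; Ex. 3.3 (ii), 3.4 (iii): the formal symbol `log(Θ)`);
Example 3.5 builds the global realified Frobenioids `C⊩_mod`, `C⊩_tht` and the collections of data
`F⊩_mod = (C⊩_mod, Prime(C⊩_mod) ⥲ V̲, {F⊢_v̲}, {ρ_v̲})`, `F⊩_tht` (same with `F^Θ`, `ρ^Θ`), with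
a natural isomorphism `F⊩_mod ⥲ F⊩_tht`. All of this rests on inputs ABSENT from the tree
(Frobenioids [FrdI/II] beyond Def. 1.3, tempered Frobenioids and the étale theta function [EtTh],
Aut-holomorphic spaces [AbsTopIII]); owners: abc-iut-L1-*, abc-iut-L2-*, abc-iut-L4-t2/t3.

**How it is typed here.** Following Remark 3.5.2 ("isomorphisms of collections of data" = systems
of compatible isomorphisms; for categories, isomorphism classes of equivalences), every KIND of
collection of data is an abstract GROUPOID and every "category-theoretic / algorithmic
construction" is a FUNCTOR between these groupoids; the reference objects and the natural /
tautological isomorphisms printed in Examples 3.2–3.5 are distinguished objects / natural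
isomorphisms. This is the INTERFACE `HodgeTheaterModel D` (one field per printed object, locator
in each docstring). Over it, Definition 3.6 (a Θ-Hodge theater = an isomorph of the reference
data), Remark 3.6.2 (isomorphisms of Θ-Hodge theaters), Corollary 3.7 (the Θ-link = the FULL
poly-isomorphism `†F⊩_tht ⥲ ‡F⊩_mod`, nonempty — PROVED here from the interface, as the text says
"follow immediately from the definitions"; (ii), (iii) the induced poly-isomorphisms on `D⊢_v` and
`O^×_{C⊢_v}`) are typed in the author's terms; Corollaries 3.8, 3.9 (Frobenius- and étale-pictures)
follow in the companion file `FrobeniusEtalePictures.lean`. Poly-isomorphisms (`PolyIso`, `PolyIso.full`) are the §0 ones of `Conventions.lean`.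

Deliberately NOT here: a `Realization` bridge identifying the objects of `Loc v` / `Glob` with the
per-place structures `BadLocalFrobenioid` / `GoodLocalFrobenioid` / `ArchLocalFrobenioid` and the
REAL divisor monoids of `GlobalRealifiedFrobenioids.lean` (to be added when [IUTchII–III] consumers
ask); a compatibility law between `tautGlob` and `tautLoc` at each `v̲` (the identification
`componentFtht` uses both; nothing below depends on it); the internal structure of `F̲_v`, `F⊢_v`,
`F⊩_mod` (Examples 3.2–3.5 (i)–(vi)
in detail: `Θ̲_v`, `q̲_v = q_v^{1/2l}`, `Φ_{C⊢_v} = ℕ·log_Φ(q̲_v)|_{D⊢_v}`, `log(p_v)·log(Θ)`, the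
`ρ_v`-formulae `log⊢_mod(p_v) ↦ [K_v:(F_mod)_v]⁻¹ log_Φ(p_v)` and the bad-place factor
`log_Φ(p_v)/([K_v:(F_mod)_v]·log_Φ(q̲_v))`, the `D`-version `F⊩_D`) — these are value-group level
statements to be typed REAL over `ℝ≥0` in a companion file; the reconstructibility claims
(Ex. 3.2 (vi) (a)–(f), 3.3 (iii) (a)–(e)); Remarks 3.2.1–3.2.4, 3.3.1–3.3.2, 3.4.1–3.4.3, 3.5.1,
3.8.1, 3.9.1–3.9.4 (expository / errata to [EtTh]; recorded in the companion Remarks file).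
-/

namespace Literature.IUT.HodgeTheaters

open CategoryTheory

universe u v w uM

/-! ### Examples 3.2–3.5 as an INTERFACE -/

section Model

variable {F : Type u} {K : Type v} {Fbar : Type w} [Field F] [NumberField F] [Field K]
  [NumberField K] [Algebra F K] [Field Fbar] [Algebra F Fbar] [Algebra K Fbar]
  {E : WeierstrassCurve F} [E.IsElliptic] {l : ℕ} {P : BadPlacePredicates K}

/-- INTERFACE for Examples 3.2, 3.3, 3.4, 3.5 relative to initial Θ-data `D`: the KINDS of
collections of data as groupoids, the constructions as functors, the reference objects and the
natural/tautological isomorphisms as distinguished data (Rmk 3.5.2). One field per printed object;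
nothing about their internal structure is assumed beyond what Def. 3.6 and Cor. 3.7–3.9 use.
[claim: Mochizuki2012, status: disputed] -/
structure HodgeTheaterModel (D : InitialThetaData F K Fbar E l P) where
  /-- for `v ∈ V̲`: the groupoid of collections of data "of the same kind as `F̲_v`" (a category with
  Frobenioid structure for `v ∈ V̲^non`, Def. 3.6 (a); a triple `(C_v, D_v, κ_v)` for `v ∈ V̲^arc`,
  Def. 3.6 (b)) and their isomorphisms -/
  Loc : D.V → Type uM
  /-- groupoid structure on `Loc v` -/
  [locGpd : ∀ v, Groupoid.{uM} (Loc v)]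
  /-- the reference object `F̲_v` (Ex. 3.2 (i), 3.3 (i), 3.4 (i)) -/
  Fref : ∀ v, Loc v
  /-- for `v ∈ V̲`: the groupoid of base categories `D_v` (`B^temp(X̲̲_v)⁰`, Ex. 3.2 (i); `B(X̲→_v)⁰`,
  Ex. 3.3 (i); the Aut-holomorphic orbispace `X̲→_v`, Ex. 3.4 (i)) -/
  BaseFull : D.V → Type uM
  /-- groupoid structure on `BaseFull v` -/
  [baseFullGpd : ∀ v, Groupoid.{uM} (BaseFull v)]
  /-- `F̲_v ↦ D_v`, "reconstructed category-theoretically from `F̲_v`" (Ex. 3.2 (vi) (d), 3.3 (iii)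
  (c); part of the data for `v ∈ V̲^arc`, Ex. 3.4 (i)) -/
  baseFullOf : ∀ v, Loc v ⥤ BaseFull v
  /-- for `v ∈ V̲`: the groupoid of split-Frobenioid-type data (`F⊢_v = (C⊢_v, τ⊢_v)`,
  `F^Θ_v = (C^Θ_v, τ^Θ_v)`; triples for `v ∈ V̲^arc`, Ex. 3.4 (ii), (iii)) -/
  Dash : D.V → Type uM
  /-- groupoid structure on `Dash v` -/
  [dashGpd : ∀ v, Groupoid.{uM} (Dash v)]
  /-- `F̲_v ↦ F⊢_v`, "constructed category-theoretically/algorithmically from `F̲_v`"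
  (Ex. 3.2 (vi) (f), 3.3 (iii) (e), 3.4 (ii)) -/
  dashOf : ∀ v, Loc v ⥤ Dash v
  /-- `F̲_v ↦ F^Θ_v` (Ex. 3.2 (vi) (e), 3.3 (iii) (e), 3.4 (iii)) -/
  thetaOf : ∀ v, Loc v ⥤ Dash v
  /-- the natural isomorphism of split Frobenioids `F⊢_v ⥲ F^Θ_v` (Ex. 3.2 (v) "`q̲_v ↦ Θ̲_v`";
  Ex. 3.3 (ii); Ex. 3.4 (iii) "forgetting the formal symbol `log(Θ)`") -/
  tautLoc : ∀ v, dashOf v ≅ thetaOf v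
  /-- for `v ∈ V̲`: the groupoid of base data `D⊢_v` (the category `B(K_v)⁰` for `v ∈ V̲^non`,
  an object of `TM⊢` for `v ∈ V̲^arc`) -/
  Base : D.V → Type uM
  /-- groupoid structure on `Base v` -/
  [baseGpd : ∀ v, Groupoid.{uM} (Base v)]
  /-- `F⊢_v ↦ D⊢_v`, `F^Θ_v ↦ D^Θ_v`: the base of a split Frobenioid (Ex. 3.2 (vi) (c), 3.3 (iii)
  (b), 3.4 (ii)) -/
  base : ∀ v, Dash v ⥤ Base v
  /-- `D_v ↦ D⊢_v` (`D⊢_v ⊆ D_v` "reconstructed category-theoretically from `D_v`", Ex. 3.2 (vi) (a),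
  3.3 (iii) (a); `D⊢_v` "algorithmically reconstructed from `D_v`", Ex. 3.4 (ii)) — the relationship
  "— —" of the étale-picture, Cor. 3.9 (i) -/
  dashOfBase : ∀ v, BaseFull v ⥤ Base v
  /-- the two routes `F̲_v ↦ D_v ↦ D⊢_v` and `F̲_v ↦ F⊢_v ↦ D⊢_v` agree -/
  baseCompat : ∀ v, baseFullOf v ⋙ dashOfBase v ≅ dashOf v ⋙ base v
  /-- for `v ∈ V̲`: the groupoid of unit data `O^×_{C⊢_v}` (a group-like monoid on `D⊢_v`, resp. a
  topological group for `v ∈ V̲^arc`; Cor. 3.7 (iii), Cor. 3.9 (ii)) -/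
  Units : D.V → Type uM
  /-- groupoid structure on `Units v` -/
  [unitsGpd : ∀ v, Groupoid.{uM} (Units v)]
  /-- `F⊢_v ↦ O^×_{C⊢_v}` (Cor. 3.7 (iii)) -/
  units : ∀ v, Dash v ⥤ Units v
  /-- the groupoid of collections of data `(C⊩, Prime(C⊩) ⥲ V̲, {F_v̲}_{v̲ ∈ V̲}, {ρ_v̲}_{v̲ ∈ V̲})`
  (Ex. 3.5 (ii); Def. 3.6 (c)) and their isomorphisms (Rmk 3.5.2) -/
  Glob : Type uM
  /-- groupoid structure on `Glob` -/
  [globGpd : Groupoid.{uM} Glob]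
  /-- the reference object `F⊩_mod = (C⊩_mod, Prime(C⊩_mod) ⥲ V̲, {F⊢_v̲}, {ρ_v̲})` (Ex. 3.5 (ii)) -/
  FmodRef : Glob
  /-- the `v̲`-component `{F_v̲}` of a collection of data (Ex. 3.5 (ii)) -/
  component : ∀ v, Glob ⥤ Dash v
  /-- the `v̲`-component of `F⊩_mod` is `F⊢_v̲ = dashOf(F̲_v̲)` (Ex. 3.5 (ii)) -/
  componentRef : ∀ v, (component v).obj FmodRef ≅ (dashOf v).obj (Fref v)
  /-- `†F⊩_mod ↦ †F⊩_tht`, "constructed algorithmically from `†F⊩_mod`" (Def. 3.6 (c); Ex. 3.5 (ii):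
  `Φ_{C⊩_tht} = Φ_{C⊩_mod}·log(Θ)`) -/
  thtOf : Glob ⥤ Glob
  /-- the natural isomorphism `F⊩_mod ⥲ F⊩_tht` (Ex. 3.5 (ii), last display: "compatible with the
  natural isomorphisms `C⊩_mod ⥲ C⊩_tht`, `C⊢_v ⥲ C^Θ_v`"), functorially in the data -/
  tautGlob : 𝟭 Glob ≅ thtOf
  /-- LAW (Ex. 3.2 (vi) (c), 3.3 (iii) (b), 3.4 (ii), 3.5 (ii); Rmk 3.5.2): the base data `D⊢_v̲` are
  "reconstructed category-theoretically / algorithmically from" the collections of data, so every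
  isomorphism of base data is induced by one of the collections: `Glob ⥤ Base v` is full (this is
  what makes the bracketed "[full]" of Cor. 3.7 (ii) hold for Θ-Hodge theaters as defined) -/
  [componentBase_full : ∀ v, (component v ⋙ base v).Full]
  /-- LAW (same locators; Cor. 3.7 (iii)): likewise every isomorphism of the unit data
  `𝒪^×_{C⊢_v̲}` is induced: `Glob ⥤ Units v` is full -/
  [componentUnits_full : ∀ v, (component v ⋙ units v).Full]

attribute [instance] HodgeTheaterModel.locGpd HodgeTheaterModel.dashGpd
  HodgeTheaterModel.baseFullGpd HodgeTheaterModel.baseGpd HodgeTheaterModel.unitsGpd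
  HodgeTheaterModel.globGpd HodgeTheaterModel.componentBase_full HodgeTheaterModel.componentUnits_full

end Model

/-! ### Definition 3.6, Remark 3.6.2 -/

section Def36

variable {F : Type u} {K : Type v} {Fbar : Type w} [Field F] [NumberField F] [Field K]
  [NumberField K] [Algebra F K] [Field Fbar] [Algebra F Fbar] [Algebra K Fbar]
  {E : WeierstrassCurve F} [E.IsElliptic] {l : ℕ} {P : BadPlacePredicates K} {D : InitialThetaData F K Fbar E l P}

/-- **[IUTchI] Definition 3.6** (p. 87): a **Θ-Hodge theater** relative to the initial Θ-data `D`
is a collection of data `†HT^Θ = ({†F̲_v}_{v ∈ V̲}, †F⊩_mod)` such that (a)/(b) each `†F̲_v` is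
isomorphic (equivalent) to the reference `F̲_v`, and (c) `†F⊩_mod` is a collection of data
`(†C⊩_mod, Prime(†C⊩_mod) ⥲ V̲, {†F⊢_v̲}, {†ρ_v̲})` with `†F⊢_v̲` "as discussed in (a), (b)" that is
isomorphic to `F⊩_mod`. Typed over the interface `M`. [claim: Mochizuki2012, status: disputed] -/
structure ThetaHodgeTheater (M : HodgeTheaterModel D) where
  /-- `{†F̲_v}_{v ∈ V̲}` -/
  loc : ∀ v, M.Loc v
  /-- (a), (b): "`†F̲_v` … admits an equivalence of categories `†F̲_v ⥲ F̲_v`" (resp. "there exists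
  an isomorphism of collections of data `†F̲_v ⥲ F̲_v`") -/
  loc_iso : ∀ v, Nonempty (loc v ≅ M.Fref v)
  /-- `†F⊩_mod` -/
  glob : M.Glob
  /-- (c): "`†F⊢_v̲` is as discussed in (a), (b) above" — the `v̲`-component of `†F⊩_mod` is the
  `†F⊢_v̲` constructed from `†F̲_v̲` (recorded as a specified identification in the groupoid) -/
  component_iso : ∀ v, (M.component v).obj glob ≅ (M.dashOf v).obj (loc v)
  /-- (c): "we require that there exist an isomorphism of collections of data `†F⊩_mod ⥲ F⊩_mod`" -/
  glob_iso : Nonempty (glob ≅ M.FmodRef)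

namespace ThetaHodgeTheater

variable {M : HodgeTheaterModel D} (HT : ThetaHodgeTheater M)

/-- `†F⊢_v`, constructed from `†F̲_v` (Def. 3.6 (a), (b)). [claim: Mochizuki2012, status: disputed] -/
def Fdash (v : D.V) : M.Dash v := (M.dashOf v).obj (HT.loc v)

/-- `†F^Θ_v`, constructed from `†F̲_v` (Def. 3.6 (a), (b)). [claim: Mochizuki2012, status: disputed] -/
def Ftheta (v : D.V) : M.Dash v := (M.thetaOf v).obj (HT.loc v)

/-- `†D_v` (Def. 3.6 (a), (b)). [claim: Mochizuki2012, status: disputed] -/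
def Dfull (v : D.V) : M.BaseFull v := (M.baseFullOf v).obj (HT.loc v)

/-- `†D⊢_v` (Def. 3.6 (a), (b)). [claim: Mochizuki2012, status: disputed] -/
def Ddash (v : D.V) : M.Base v := (M.base v).obj (HT.Fdash v)

/-- `†D_v` "— —" `†D⊢_v`: the two constructions of `†D⊢_v` agree (Ex. 3.2 (vi), 3.3 (iii), 3.4 (ii)).
[claim: Mochizuki2012, status: disputed] -/
def dashOfDfull (v : D.V) : (M.dashOfBase v).obj (HT.Dfull v) ≅ HT.Ddash v :=
  (M.baseCompat v).app (HT.loc v)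

/-- `†D^Θ_v` (Def. 3.6 (a), (b)). [claim: Mochizuki2012, status: disputed] -/
def Dtheta (v : D.V) : M.Base v := (M.base v).obj (HT.Ftheta v)

/-- `O^×_{†C⊢_v}` (Cor. 3.7 (iii)). [claim: Mochizuki2012, status: disputed] -/
def unitsDash (v : D.V) : M.Units v := (M.units v).obj (HT.Fdash v)

/-- `O^×_{†C^Θ_v}` (Cor. 3.7 (iii)). [claim: Mochizuki2012, status: disputed] -/
def unitsTheta (v : D.V) : M.Units v := (M.units v).obj (HT.Ftheta v)

/-- `†F⊩_tht`, "constructed algorithmically from `†F⊩_mod`" (Def. 3.6 (c)).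
[claim: Mochizuki2012, status: disputed] -/
def Ftht : M.Glob := M.thtOf.obj HT.glob

/-- The tautological isomorphism `†D⊢_v ⥲ †D^Θ_v` (Cor. 3.7 (ii): "which arise from the definitions
when `v ∈ V̲^good`, and … from a natural product functor when `v ∈ V̲^bad`").
[claim: Mochizuki2012, status: disputed] -/
def tautBase (v : D.V) : HT.Ddash v ≅ HT.Dtheta v := (M.base v).mapIso ((M.tautLoc v).app (HT.loc v))

/-- The tautological isomorphism `O^×_{†C⊢_v} ⥲ O^×_{†C^Θ_v}` (Cor. 3.7 (iii)).
[claim: Mochizuki2012, status: disputed] -/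
def tautUnits (v : D.V) : HT.unitsDash v ≅ HT.unitsTheta v :=
  (M.units v).mapIso ((M.tautLoc v).app (HT.loc v))

/-- Remark 3.6.2: "an evident notion of isomorphism of Θ-Hodge theaters" — compatible families of
isomorphisms of the constituent data (Rmk 3.5.2 (i)). [claim: Mochizuki2012, status: disputed] -/
structure Iso (HT HT' : ThetaHodgeTheater M) where
  /-- `†F̲_v ⥲ ‡F̲_v` -/
  locIso : ∀ v, HT.loc v ≅ HT'.loc v
  /-- `†F⊩_mod ⥲ ‡F⊩_mod` -/
  globIso : HT.glob ≅ HT'.glob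
  /-- the evident compatibility at each `v̲`-component -/
  comm : ∀ v, (M.component v).mapIso globIso ≪≫ HT'.component_iso v =
    HT.component_iso v ≪≫ (M.dashOf v).mapIso (locIso v)

/-- The reference data themselves form a Θ-Hodge theater (implicit in Def. 3.6).
[claim: Mochizuki2012, status: disputed] -/
def ref (M : HodgeTheaterModel D) : ThetaHodgeTheater M where
  loc := M.Fref
  loc_iso _ := ⟨Iso.refl _⟩
  glob := M.FmodRef
  component_iso := M.componentRef
  glob_iso := ⟨Iso.refl _⟩

end ThetaHodgeTheater

end Def36

/-! ### Corollary 3.7: the Θ-link -/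

section Cor37

variable {F : Type u} {K : Type v} {Fbar : Type w} [Field F] [NumberField F] [Field K]
  [NumberField K] [Algebra F K] [Field Fbar] [Algebra F Fbar] [Algebra K Fbar]
  {E : WeierstrassCurve F} [E.IsElliptic] {l : ℕ} {P : BadPlacePredicates K} {D : InitialThetaData F K Fbar E l P}
  {M : HodgeTheaterModel D} (HT HT' : ThetaHodgeTheater M)

namespace ThetaHodgeTheater

/-- **Corollary 3.7 (i)** (p. 88), the **Θ-link** `†HT^Θ ⟶^Θ ‡HT^Θ`: "the full poly-isomorphism
between collections of data `†F⊩_tht ⥲ ‡F⊩_mod`". [claim: Mochizuki2012, status: disputed] -/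
def thetaLink : PolyIso HT.Ftht HT'.glob := PolyIso.full HT.Ftht HT'.glob

/-- **Corollary 3.7 (i)**: the Θ-link "is nonempty" — PROVED from the interface ("follow immediately
from the definitions": `†F⊩_tht ≅ †F⊩_mod ≅ F⊩_mod ≅ ‡F⊩_mod` via the natural isomorphism of
Ex. 3.5 (ii) and Def. 3.6 (c)). [claim: Mochizuki2012, status: disputed] -/
theorem thetaLink_nonempty : (HT.thetaLink HT').Nonempty := by
  obtain ⟨e⟩ := HT.glob_iso
  obtain ⟨e'⟩ := HT'.glob_iso
  exact ⟨(M.tautGlob.app HT.glob).symm ≪≫ e ≪≫ e'.symm, Set.mem_univ _⟩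

/-- Remark 3.7.1: "there exist many distinct isomorphisms `†F⊩_tht ⥲ ‡F⊩_mod` … none of which is
conferred a 'distinguished' status" — the Θ-link is the FULL poly-isomorphism (by definition).
[claim: Mochizuki2012, status: disputed] -/
theorem thetaLink_eq_univ : HT.thetaLink HT' = Set.univ := rfl

/-- `†F^Θ_v` is the `v̲`-component of `†F⊩_tht` (Def. 3.6 (c): "`†F⊩_tht` … correspond[s] to the
objects without a `†`", Ex. 3.5 (ii)), via the natural isomorphisms of the interface.
[claim: Mochizuki2012, status: disputed] -/
def componentFtht (v : D.V) : (M.component v).obj HT.Ftht ≅ HT.Ftheta v :=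
  (M.component v).mapIso (M.tautGlob.app HT.glob).symm ≪≫ HT.component_iso v ≪≫
    (M.tautLoc v).app (HT.loc v)

/-- The isomorphism `†F^Θ_v ⥲ ‡F⊢_v` induced on `v̲`-components by a member `φ` of the Θ-link
(Cor. 3.7 (ii), (iii): "the poly-isomorphism induced by the Θ-link poly-isomorphism of (i)").
[claim: Mochizuki2012, status: disputed] -/
def linkComponent (v : D.V) (φ : HT.Ftht ≅ HT'.glob) : HT.Ftheta v ≅ HT'.Fdash v :=
  (HT.componentFtht v).symm ≪≫ (M.component v).mapIso φ ≪≫ HT'.component_iso v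

/-- **Corollary 3.7 (ii)** (Preservation of "`D⊢`"), p. 88: the composite poly-isomorphism
`†D⊢_v ⥲ †D^Θ_v ⥲ ‡D⊢_v` of the tautological isomorphism with the poly-isomorphism induced by the
Θ-link. [claim: Mochizuki2012, status: disputed] -/
def thetaLinkBase (v : D.V) : PolyIso (HT.Ddash v) (HT'.Ddash v) :=
  {h | ∃ φ ∈ HT.thetaLink HT', h = HT.tautBase v ≪≫ (M.base v).mapIso (HT.linkComponent HT' v φ)}

/-- **Corollary 3.7 (ii)**, the bracketed claim "[full] poly-isomorphism": the composite
poly-isomorphism `†D⊢_v ⥲ ‡D⊢_v` is the full one — typed as a statement.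
[claim: Mochizuki2012, status: disputed] -/
def ThetaLinkBaseFull (HT HT' : ThetaHodgeTheater M) (v : D.V) : Prop :=
  HT.thetaLinkBase HT' v = PolyIso.full _ _

/-- **Corollary 3.7 (iii)** (Preservation of "`O^×`"), p. 89: the composite poly-isomorphism
`O^×_{†C⊢_v} ⥲ O^×_{†C^Θ_v} ⥲ O^×_{‡C⊢_v}`. [claim: Mochizuki2012, status: disputed] -/
def thetaLinkUnits (v : D.V) : PolyIso (HT.unitsDash v) (HT'.unitsDash v) :=
  {h | ∃ φ ∈ HT.thetaLink HT', h = HT.tautUnits v ≪≫ (M.units v).mapIso (HT.linkComponent HT' v φ)}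

/-- **Corollary 3.7 (iii)**, the bracketed claim "[full] poly-isomorphism" — typed as a statement.
[claim: Mochizuki2012, status: disputed] -/
def ThetaLinkUnitsFull (HT HT' : ThetaHodgeTheater M) (v : D.V) : Prop :=
  HT.thetaLinkUnits HT' v = PolyIso.full _ _

/-- Cor. 3.7 (ii)/(iii): the induced poly-isomorphisms are nonempty (from (i)).
[claim: Mochizuki2012, status: disputed] -/
theorem thetaLinkBase_nonempty (v : D.V) : (HT.thetaLinkBase HT' v).Nonempty := by
  obtain ⟨φ, hφ⟩ := HT.thetaLink_nonempty HT'
  exact ⟨_, φ, hφ, rfl⟩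

/-- Cor. 3.7 (ii)+(iii) together, for the pair "`D⊢_v ↷ 𝒪^×_{C⊢_v}`" of Cor. 3.9 (ii): the
poly-isomorphism of pairs induced by the Θ-link (same member `φ` on both components), as isomorphisms
in the product groupoid `Base v × Units v` (which records the two components side by side; the
datum "`𝒪^×` is a monoid ON `D⊢_v`" is not a functor of the interface). [claim: Mochizuki2012, status: disputed] -/
def thetaLinkPair (v : D.V) :
    PolyIso ((HT.Ddash v, HT.unitsDash v) : M.Base v × M.Units v) (HT'.Ddash v, HT'.unitsDash v) :=
  {h | ∃ φ ∈ HT.thetaLink HT',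
    h = Iso.prod (HT.tautBase v ≪≫ (M.base v).mapIso (HT.linkComponent HT' v φ))
      (HT.tautUnits v ≪≫ (M.units v).mapIso (HT.linkComponent HT' v φ))}

/-- The pair poly-isomorphism is nonempty (from (i)). [claim: Mochizuki2012, status: disputed] -/
theorem thetaLinkPair_nonempty (v : D.V) : (HT.thetaLinkPair HT' v).Nonempty := by
  obtain ⟨φ, hφ⟩ := HT.thetaLink_nonempty HT'
  exact ⟨_, φ, hφ, rfl⟩

end ThetaHodgeTheater

end Cor37

end Literature.IUT.HodgeTheaters
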